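import Mathlib
import Literature.NumberTheory.GaloisRepresentations.SGeneralQuadraticFamily
import Literature.NumberTheory.Automorphic.TunnellOctahedralLocal

/-!
# Icosahedral descent (crux `IcosahedralDescentLevel`, line `Sketch`) — the inert witness prime

For the auxiliary imaginary quadratic field `K = ℚ(√-D)` of the line (`sqrtNegField ℚ D`,
Mathlib's `QuadraticAlgebra ℚ (-D) 0`, `ω² = -D`) and a prime `ℓ` modulo which `-D` is a
non-residue, in the elementary form `∀ x : ℤ, ℓ ∤ x² + D`, every finite place `u` of `K` above the
place `v ∋ ℓ` of `ℚ` has residue degree `f(u|v) = 2`, i.e. `ℓ` is inert in `K`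
(`inertiaDeg_eq_two_of_nonsquare`).

Residue-field argument, no ramification theory: `f ∈ {1, 2}`
(`inertiaDeg_eq_one_or_two_of_finrank_eq_two`); if `f = 1` the residue extension
`𝓞 ℚ / v → 𝓞 K / u` is onto, so the algebraic integer `ω` is `≡ c (mod u)` for some `c ∈ 𝓞 ℚ`,
whence `c² + D ∈ u ∩ 𝓞 ℚ = v`; and a prime of `𝓞 ℚ ≃ ℤ` containing the rational prime `ℓ` is
`ℓℤ`, so `ℓ ∣ c² + D`, a contradiction.  Modelled on
`Literature.NumberTheory.QuadraticForms.Inert.inertiaDegIn_ne_one` (`InertQuadraticExtension`).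
-/

-- `Summit.Langlands.Langlands.…`: the repeated path component is the tree's layout (D-0017).
set_option linter.dupNamespace false

noncomputable section

open scoped NumberField
open NumberField IsDedekindDomain
open Literature.NumberTheory.GaloisRepresentations Literature.NumberTheory.GaloisRepresentations.QuadraticFamily

namespace Summit.Langlands.Langlands.Theorems.IcosahedralDescentLevel

/-- `ω = √-D ∈ ℚ(√-D)` is an algebraic integer (`ω² = -D ∈ ℤ`). [folklore] -/
theorem isIntegral_int_omega (D : ℕ) :
    IsIntegral ℤ (QuadraticAlgebra.omega : sqrtNegField ℚ D) := by
  refine IsIntegral.of_pow two_pos ?_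
  rw [omega_sq, map_neg, map_natCast, ← map_natCast (algebraMap ℤ (sqrtNegField ℚ D)) D]
  exact isIntegral_algebraMap.neg

/-- A prime `v` of `𝓞 ℚ ≃ ℤ` containing the rational prime `ℓ` is `ℓℤ`: membership in `v` is
divisibility by `ℓ` (transport along `Rat.ringOfIntegersEquiv`; `ℓℤ` is maximal). [folklore] -/
theorem natCast_dvd_of_mem (ℓ : ℕ) (hℓ : ℓ.Prime) (v : HeightOneSpectrum (𝓞 ℚ))
    (hv : ((ℓ : ℕ) : 𝓞 ℚ) ∈ v.asIdeal) {a : 𝓞 ℚ} (ha : a ∈ v.asIdeal) :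
    (ℓ : ℤ) ∣ Rat.ringOfIntegersEquiv a := by
  set e : 𝓞 ℚ ≃+* ℤ := Rat.ringOfIntegersEquiv
  haveI : (v.asIdeal.comap (e.symm : ℤ →+* 𝓞 ℚ)).IsPrime := Ideal.comap_isPrime _ _
  have hmax : (Ideal.span {(ℓ : ℤ)}).IsMaximal :=
    PrincipalIdealRing.isMaximal_of_irreducible (Nat.prime_iff_prime_int.mp hℓ).irreducible
  have hI : Ideal.span {(ℓ : ℤ)} = v.asIdeal.comap (e.symm : ℤ →+* 𝓞 ℚ) := by
    refine hmax.eq_of_le Ideal.IsPrime.ne_top' ?_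
    rw [Ideal.span_singleton_le_iff_mem, Ideal.mem_comap]
    simpa using hv
  rw [← Ideal.mem_span_singleton, hI, Ideal.mem_comap, RingEquiv.coe_toRingHom,
    RingEquiv.symm_apply_apply]
  exact ha

/-- **`ℓ` is inert in `ℚ(√-D)` when `-D` is a non-residue mod `ℓ`.**  If `-D` is a non-residue
modulo the prime `ℓ ∈ v`, then every place `u` of `ℚ(√-D)` above `v` has residue degree `2`
(the residue-field argument: were `f(u|v) = 1`, the algebraic integer `ω`, `ω² = -D`, would be
congruent modulo `u` to some `c ∈ 𝓞 ℚ`, and `c² + D ∈ u ∩ 𝓞 ℚ = v = ℓℤ`). [folklore] -/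
theorem inertiaDeg_eq_two_of_nonsquare (D : ℕ) [Fact (¬ IsSquare (-(D : ℚ)))] (ℓ : ℕ) (hℓ : ℓ.Prime)
    (hns : ∀ x : ℤ, ¬ ((ℓ : ℤ) ∣ x ^ 2 + D)) (v : HeightOneSpectrum (𝓞 ℚ))
    (hv : ((ℓ : ℕ) : 𝓞 ℚ) ∈ v.asIdeal) (u : HeightOneSpectrum (𝓞 (sqrtNegField ℚ D)))
    (hu : u.asIdeal.under (𝓞 ℚ) = v.asIdeal) : u.asIdeal.inertiaDeg (𝓞 ℚ) = 2 := by
  rcases Literature.NumberTheory.Automorphic.inertiaDeg_eq_one_or_two_of_finrank_eq_two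
    finrank_sqrtNegField v u hu with h1 | h2
  swap
  · exact h2
  exfalso
  haveI : v.asIdeal.IsMaximal := v.isMaximal
  haveI : u.asIdeal.IsMaximal := u.isMaximal
  haveI : u.asIdeal.LiesOver v.asIdeal := ⟨hu.symm⟩
  rw [Ideal.inertiaDeg_eq_of_isMaximal v.asIdeal u.asIdeal] at h1
  letI : Field (𝓞 ℚ ⧸ v.asIdeal) := Ideal.Quotient.field v.asIdeal
  -- `ω ∈ 𝓞 K`, `ω² + D = 0` in `𝓞 K`
  obtain ⟨y, hy⟩ : ∃ y : 𝓞 (sqrtNegField ℚ D), (y : sqrtNegField ℚ D) = QuadraticAlgebra.omega :=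
    ⟨⟨QuadraticAlgebra.omega, (mem_integralClosure_iff ℤ _).mpr (isIntegral_int_omega D)⟩, rfl⟩
  have hyy : y ^ 2 + (D : 𝓞 (sqrtNegField ℚ D)) = 0 := by
    apply RingOfIntegers.coe_injective
    rw [map_add, map_pow, map_natCast, map_zero]
    change (y : sqrtNegField ℚ D) ^ 2 + (D : sqrtNegField ℚ D) = 0
    rw [hy, omega_sq, map_neg, map_natCast, neg_add_cancel]
  -- the residue of `ω` lies in the image of `𝓞 ℚ ⧸ v` (the residue extension has degree `1`)
  have hbot : Ideal.Quotient.mk u.asIdeal y ∈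
      (⊥ : Subalgebra (𝓞 ℚ ⧸ v.asIdeal) (𝓞 (sqrtNegField ℚ D) ⧸ u.asIdeal)) := by
    rw [Subalgebra.bot_eq_top_iff_finrank_eq_one.mpr h1]
    exact Algebra.mem_top
  obtain ⟨c', hc'⟩ := Algebra.mem_bot.mp hbot
  obtain ⟨c, rfl⟩ := Ideal.Quotient.mk_surjective c'
  rw [Ideal.Quotient.algebraMap_mk_of_liesOver] at hc'
  -- hence `c² + D ≡ ω² + D = 0 (mod u)`, i.e. `c² + D ∈ u ∩ 𝓞 ℚ = v`
  have hmem : algebraMap (𝓞 ℚ) (𝓞 (sqrtNegField ℚ D)) (c ^ 2 + D) ∈ u.asIdeal := by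
    rw [← Ideal.Quotient.eq_zero_iff_mem, map_add, map_pow, map_natCast, map_add, map_pow, hc',
      ← map_pow, ← map_add, hyy, map_zero]
  have hcv : c ^ 2 + (D : 𝓞 ℚ) ∈ v.asIdeal :=
    (Ideal.mem_of_liesOver u.asIdeal v.asIdeal _).mpr hmem
  -- transport to `ℤ`: `ℓ ∣ c² + D`
  refine hns (Rat.ringOfIntegersEquiv c) ?_
  have h := natCast_dvd_of_mem ℓ hℓ v hv hcv
  rwa [map_add, map_pow, map_natCast] at h

end Summit.Langlands.Langlands.Theorems.IcosahedralDescentLevel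

end
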